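import Mathlib
import Literature.NumberTheory.LFunctions.LogFreeDensityTheorem14
import Literature.NumberTheory.LFunctions.ZetaZeroFreeRegion
import Literature.NumberTheory.LFunctions.ZetaLogDerivDisc
import Literature.NumberTheory.LFunctions.GeneralizedRH
import Literature.NumberTheory.LFunctions.ZetaEulerProductMeanSquare

/-!
# (Z2) Few bad conductors — the grand log-free zero-density theorem

Stub `stub_fewBadConductors` of the line `positivity-quarantine` for the crux `DilatedTableChowla`
(route `LiouvilleShiftedTables`, summit `Parity/GeneralizedHardyLittlewood`).

A modulus `d` is *bad* at scale `x` when some `L(s, χ)`, `χ mod d`, has a zero `z ≠ 1` in the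
LINNIK BOX `1 − K' log log x / log x < re z`, `|im z| ≤ (log x)^H`.  We prove: for every
`θ, K', H` there are `E₀, x₀` such that for `x ≥ x₀` the bad moduli `d ≤ x^θ` are all multiples
of a set `S` of at most `(log x)^{E₀}` bad moduli — `S` := the moduli `f ∈ [2, x^{max θ 1}]`
carrying a PRIMITIVE character with a box zero.
* Cover: a box zero `z` of `χ mod d` is not a zero of a principal `L`-function (de la Vallée
  Poussin's region for `ζ`, all heights, `ClassicalZFRData.zeroFree` for
  `classicalZFRData_riemannZeta`, contains the box for large `x`; Euler factors do not vanish on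
  `re s > 0`), so `χ ≠ χ₀`, its conductor `f ≥ 2` divides `d`, and `z` is a zero of `L(s, χ⋆)`
  for the primitive `χ⋆` inducing `χ` (`LFunction_eq_zero_iff_primitiveCharacter`).
* Count: one box zero per primitive character and Bombieri's THÉORÈME 14
  (`LogFreeDensity.logFreeDensity_dirichlet`) with `P = x^{max θ 1}`,
  `α = 1 − K⁺ log log x / log x` (`K⁺ = max K' 0`): `#S ≤ C_D P^{c_D(1−α)}
  = C_D (log x)^{c_D · max θ 1 · K⁺} ≤ (log x)^{E₀}`, `E₀ = c_D · max θ 1 · K⁺ + 1`.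

References: E. Bombieri, *Le grand crible dans la théorie analytique des nombres*, Astérisque 18
(1987), §6 Théorème 14; H. L. Montgomery, R. C. Vaughan, *Multiplicative Number Theory I*,
CUP 2007, Theorem 6.6, §10.1 (10.20).
-/

noncomputable section

open Filter Finset Real
open scoped Topology

namespace Summit.Parity.GeneralizedHardyLittlewood.Theorems.DilatedTableChowla.FewBadConductors

open Literature.NumberTheory.LFunctions Literature.NumberTheory.LFunctions.DirichletDisc
  Literature.NumberTheory.LFunctions.LogFreeDensity

/-! ### Elementary asymptotics -/

/-- For every real `A` and natural `k`, `A (log log x)^k ≤ log x` for all large `x`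
(`(log log x)^k e^{-log log x} → 0`). [folklore] -/
theorem eventually_mul_loglog_pow_le_log (A : ℝ) (k : ℕ) :
    ∀ᶠ x : ℝ in atTop, A * Real.log (Real.log x) ^ k ≤ Real.log x := by
  have h1 : Tendsto (fun x : ℝ => Real.log (Real.log x)) atTop atTop :=
    Real.tendsto_log_atTop.comp Real.tendsto_log_atTop
  have h2 : Tendsto (fun x : ℝ => Real.log (Real.log x) ^ k * Real.exp (-Real.log (Real.log x)))
      atTop (𝓝 0) :=
    (Real.tendsto_pow_mul_exp_neg_atTop_nhds_zero k).comp h1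
  have hA : (0 : ℝ) < 1 / (|A| + 1) := by positivity
  filter_upwards [h2.eventually (gt_mem_nhds hA), Real.tendsto_log_atTop.eventually_gt_atTop 1,
    h1.eventually_ge_atTop 0] with x hx hL hu
  have hL0 : 0 < Real.log x := by linarith
  rw [Real.exp_neg, Real.exp_log hL0, ← div_eq_mul_inv, div_lt_div_iff₀ hL0 (by positivity),
    one_mul] at hx
  have hk : 0 ≤ Real.log (Real.log x) ^ k := pow_nonneg hu k
  calc A * Real.log (Real.log x) ^ k ≤ |A| * Real.log (Real.log x) ^ k :=
        mul_le_mul_of_nonneg_right (le_abs_self A) hk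
    _ ≤ Real.log (Real.log x) ^ k * (|A| + 1) := by nlinarith
    _ ≤ Real.log x := hx.le

/-- Elementary consequences of `2 ≤ x`, `4 ≤ log x`, `4 K⁺ log log x ≤ log x` (`K⁺ = max K' 0`):
with `α = 1 − K⁺ log log x / log x` one has `0 < log x`, `0 ≤ log log x`, `3/4 ≤ α ≤ 1` and
`α ≤ 1 − K' log log x / log x` (the edge of the Linnik box). [folklore] -/
theorem basic {x K' : ℝ} (hL : 4 ≤ Real.log x)
    (hK : 4 * max K' 0 * Real.log (Real.log x) ≤ Real.log x) :
    0 < Real.log x ∧ 0 ≤ Real.log (Real.log x) ∧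
      3 / 4 ≤ 1 - max K' 0 * Real.log (Real.log x) / Real.log x ∧
      1 - max K' 0 * Real.log (Real.log x) / Real.log x ≤ 1 ∧
      1 - max K' 0 * Real.log (Real.log x) / Real.log x ≤
        1 - K' * Real.log (Real.log x) / Real.log x := by
  have hL0 : 0 < Real.log x := by linarith
  have hu0 : 0 ≤ Real.log (Real.log x) := Real.log_nonneg (by linarith)
  refine ⟨hL0, hu0, ?_, ?_, ?_⟩
  · have : max K' 0 * Real.log (Real.log x) / Real.log x ≤ 1 / 4 := by
      rw [div_le_div_iff₀ hL0 (by norm_num : (0 : ℝ) < 4)]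
      linarith
    linarith
  · have : 0 ≤ max K' 0 * Real.log (Real.log x) / Real.log x :=
      div_nonneg (mul_nonneg (le_max_right _ _) hu0) hL0.le
    linarith
  · have : K' * Real.log (Real.log x) / Real.log x ≤
        max K' 0 * Real.log (Real.log x) / Real.log x :=
      div_le_div_of_nonneg_right (mul_le_mul_of_nonneg_right (le_max_left _ _) hu0) hL0.le
    linarith

/-- The Linnik box lies in de la Vallée Poussin's region for large `x`: if
`8 K⁺ log log x ≤ c log x` and `2 K⁺ |H| (log log x)² ≤ c log x` (`log x ≥ 4`) then
`K' log log x / log x ≤ c / log((log x)^H + 4)`. [folklore] -/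
theorem box_subset_region {x K' H c : ℝ} (hc : 0 < c) (hL : 4 ≤ Real.log x)
    (h1 : 8 * max K' 0 / c * Real.log (Real.log x) ≤ Real.log x)
    (h2 : 2 * max K' 0 * |H| / c * Real.log (Real.log x) ^ 2 ≤ Real.log x) :
    K' * Real.log (Real.log x) / Real.log x ≤ c / Real.log (Real.log x ^ H + 4) := by
  set L := Real.log x with hLdef
  set u := Real.log L with hudef
  have hL0 : 0 < L := by linarith
  have hL1 : 1 ≤ L := by linarith
  have hu0 : 0 ≤ u := Real.log_nonneg hL1
  have hLH : 1 ≤ L ^ |H| := Real.one_le_rpow hL1 (abs_nonneg H)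
  have hLH' : L ^ H ≤ L ^ |H| := Real.rpow_le_rpow_of_exponent_le hL1 (le_abs_self H)
  have hLHpos : 0 ≤ L ^ H := Real.rpow_nonneg hL0.le H
  have hpos : 0 < L ^ H + 4 := by linarith
  have hlog4 : 0 < Real.log (L ^ H + 4) := Real.log_pos (by linarith)
  have hlogle : Real.log (L ^ H + 4) ≤ 4 + |H| * u := by
    have h5 : L ^ H + 4 ≤ 5 * L ^ |H| := by linarith
    calc Real.log (L ^ H + 4) ≤ Real.log (5 * L ^ |H|) := Real.log_le_log hpos h5
      _ = Real.log 5 + |H| * u := by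
          rw [Real.log_mul (by norm_num) (by positivity), Real.log_rpow hL0]
      _ ≤ 4 + |H| * u := by
          have : Real.log 5 ≤ 5 - 1 := Real.log_le_sub_one_of_pos (by norm_num)
          linarith
  rw [div_le_div_iff₀ hL0 hlog4]
  have hK : K' ≤ max K' 0 := le_max_left _ _
  have hKp : 0 ≤ max K' 0 := le_max_right _ _
  have h1' : 8 * max K' 0 * u ≤ L * c := by
    rw [← div_le_iff₀ hc]
    calc 8 * max K' 0 * u / c = 8 * max K' 0 / c * u := by ring
      _ ≤ L := h1
  have h2' : 2 * max K' 0 * |H| * u ^ 2 ≤ L * c := by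
    rw [← div_le_iff₀ hc]
    calc 2 * max K' 0 * |H| * u ^ 2 / c = 2 * max K' 0 * |H| / c * u ^ 2 := by ring
      _ ≤ L := h2
  calc K' * u * Real.log (L ^ H + 4) ≤ max K' 0 * u * Real.log (L ^ H + 4) :=
        mul_le_mul_of_nonneg_right (mul_le_mul_of_nonneg_right hK hu0) hlog4.le
    _ ≤ max K' 0 * u * (4 + |H| * u) := mul_le_mul_of_nonneg_left hlogle (mul_nonneg hKp hu0)
    _ = 8 * max K' 0 * u / 2 + 2 * max K' 0 * |H| * u ^ 2 / 2 := by ring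
    _ ≤ L * c / 2 + L * c / 2 := by gcongr
    _ = c * L := by ring

/-- Heights: for `x ≥ 2`, `log x ≥ 4`, `|H| log log x ≤ log x` and `θ' ≥ 1`,
`(log x)^H ≤ (x^{θ'})^6`. [folklore] -/
theorem log_rpow_le_pow_six {x H θ' : ℝ} (hx : 2 ≤ x) (hL : 4 ≤ Real.log x)
    (hH : |H| * Real.log (Real.log x) ≤ Real.log x) (hθ : 1 ≤ θ') :
    Real.log x ^ H ≤ (x ^ θ') ^ (6 : ℕ) := by
  have hx0 : 0 < x := by linarith
  have hx1 : 1 ≤ x := by linarith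
  have hL0 : 0 < Real.log x := by linarith
  have hu0 : 0 ≤ Real.log (Real.log x) := Real.log_nonneg (by linarith)
  have hP1 : 1 ≤ x ^ θ' := Real.one_le_rpow hx1 (by linarith)
  calc Real.log x ^ H = Real.exp (Real.log (Real.log x) * H) := Real.rpow_def_of_pos hL0 H
    _ ≤ Real.exp (Real.log x) := by
        refine Real.exp_le_exp.2 ?_
        calc Real.log (Real.log x) * H ≤ Real.log (Real.log x) * |H| :=
              mul_le_mul_of_nonneg_left (le_abs_self H) hu0
          _ = |H| * Real.log (Real.log x) := mul_comm _ _
          _ ≤ Real.log x := hH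
    _ = x := Real.exp_log hx0
    _ ≤ x ^ θ' := Real.self_le_rpow_of_one_le hx1 hθ
    _ ≤ (x ^ θ') ^ (6 : ℕ) := le_self_pow₀ hP1 (by norm_num)

/-- The density bound in the count: `C_D P^{c_D(1−α)} ≤ (log x)^{E₀}` for `P = x^{θ'}`,
`α = 1 − K⁺ log log x / log x`, `E₀ = c_D θ' K⁺ + 1`, once `C_D ≤ log x` (`x ≥ 2`, `log x ≥ 4`):
indeed `P^{c_D(1−α)} = exp(c_D θ' K⁺ log log x) = (log x)^{c_D θ' K⁺}`. [folklore] -/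
theorem density_bound_le {x θ' Kp c_D C_D : ℝ} (hx : 2 ≤ x) (hL : 4 ≤ Real.log x)
    (hC : C_D ≤ Real.log x) :
    C_D * (x ^ θ') ^ (c_D * (1 - (1 - Kp * Real.log (Real.log x) / Real.log x))) ≤
      Real.log x ^ (c_D * θ' * Kp + 1) := by
  have hx0 : 0 < x := by linarith
  have hL0 : 0 < Real.log x := by linarith
  have hLne : Real.log x ≠ 0 := hL0.ne'
  have hid : (x ^ θ') ^ (c_D * (1 - (1 - Kp * Real.log (Real.log x) / Real.log x))) =
      Real.log x ^ (c_D * θ' * Kp) := by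
    rw [← Real.rpow_mul hx0.le, Real.rpow_def_of_pos hx0, Real.rpow_def_of_pos hL0]
    congr 1
    field_simp
    ring
  rw [hid]
  calc C_D * Real.log x ^ (c_D * θ' * Kp) ≤ Real.log x * Real.log x ^ (c_D * θ' * Kp) :=
        mul_le_mul_of_nonneg_right hC (Real.rpow_nonneg hL0.le _)
    _ = Real.log x ^ (c_D * θ' * Kp + 1) := by
        rw [Real.rpow_add hL0, Real.rpow_one, mul_comm]

/-! ### Principal characters are never bad; transfer to the primitive character -/

/-- In de la Vallée Poussin's region (`σ > 1/2`, `σ > 1 − c/log(|t| + 4)`, where `ζ₁ ≠ 0`) the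
principal `L`-functions have no zeros off `s = 1`: `L(s, χ₀) = ζ(s) ∏_{p ∣ d} (1 − p^{−s})`
(Mathlib `LFunctionTrivChar_eq_mul_riemannZeta`; the Euler factors do not vanish on `re s > 0`,
`EulerProductMeanSquare.one_sub_prime_cpow_ne_zero`). [folklore] -/
theorem LFunction_one_ne_zero {c : ℝ}
    (hzfr : ∀ s : ℂ, 1 - 1 / 2 < s.re → 1 - c / Real.log (|s.im| + 4) < s.re → riemannZeta₁ s ≠ 0)
    (d : ℕ) [NeZero d] {z : ℂ} (hz1 : z ≠ 1) (hre : 1 / 2 < z.re)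
    (hreg : 1 - c / Real.log (|z.im| + 4) < z.re) :
    (1 : DirichletCharacter ℂ d).LFunction z ≠ 0 := by
  change DirichletCharacter.LFunctionTrivChar d z ≠ 0
  rw [DirichletCharacter.LFunctionTrivChar_eq_mul_riemannZeta hz1]
  refine mul_ne_zero (prod_ne_zero_iff.2 fun p hp => ?_) fun h => ?_
  · exact EulerProductMeanSquare.one_sub_prime_cpow_ne_zero (Nat.prime_of_mem_primeFactors hp)
      (by linarith)
  · exact hzfr z (by linarith) hreg ((riemannZeta₁_eq_zero_iff hz1).2 h)

/-- **Cover.** For `x` large (the numerical hypotheses), a zero `z ≠ 1` of `L(s, χ)`, `χ mod d`,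
`d ≤ x^θ`, in the box `1 − K' log log x/log x < re z`, `|im z| ≤ (log x)^H` is not a zero of a
principal `L`-function (de la Vallée Poussin), so `χ ≠ χ₀`, the conductor `f` of `χ` satisfies
`2 ≤ f ≤ ⌊x^{max θ 1}⌋`, and `z` is a zero of `L(s, χ⋆)` for the primitive character `χ⋆` inducing
`χ` (`DirichletCharacter.LFunction_eq_zero_iff_primitiveCharacter`: the Euler factors
`1 − χ⋆(p)p^{−s}` do not vanish on `re s > 0`). [folklore] -/
theorem cover {x θ K' H c : ℝ} (hc : 0 < c)
    (hzfr : ∀ s : ℂ, 1 - 1 / 2 < s.re → 1 - c / Real.log (|s.im| + 4) < s.re → riemannZeta₁ s ≠ 0)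
    (hx : 1 ≤ x) (hL : 0 < Real.log x)
    (hedge : 1 / 2 < 1 - K' * Real.log (Real.log x) / Real.log x)
    (hreg : K' * Real.log (Real.log x) / Real.log x ≤ c / Real.log (Real.log x ^ H + 4))
    {d : ℕ} [NeZero d] (χ : DirichletCharacter ℂ d) {z : ℂ} (hd : (d : ℝ) ≤ x ^ θ)
    (hre : 1 - K' * Real.log (Real.log x) / Real.log x < z.re) (him : |z.im| ≤ Real.log x ^ H)
    (hz1 : z ≠ 1) (hLz : χ.LFunction z = 0) :
    χ ≠ 1 ∧ 2 ≤ χ.conductor ∧ χ.conductor ≤ ⌊x ^ max θ 1⌋₊ ∧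
      (haveI : NeZero χ.conductor := ⟨χ.conductor_ne_zero⟩;
        χ.primitiveCharacter.LFunction z = 0) := by
  have hre2 : 1 / 2 < z.re := by linarith
  have hχ1 : χ ≠ 1 := by
    rintro rfl
    refine LFunction_one_ne_zero hzfr d hz1 hre2 ?_ hLz
    have h4 : 0 < Real.log (|z.im| + 4) := Real.log_pos (by linarith [abs_nonneg z.im])
    have hLH : 0 ≤ Real.log x ^ H := Real.rpow_nonneg hL.le H
    have hmono : Real.log (|z.im| + 4) ≤ Real.log (Real.log x ^ H + 4) :=
      Real.log_le_log (by linarith [abs_nonneg z.im]) (by linarith)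
    have : c / Real.log (Real.log x ^ H + 4) ≤ c / Real.log (|z.im| + 4) :=
      div_le_div_of_nonneg_left hc.le h4 hmono
    linarith
  haveI hf0 : NeZero χ.conductor := ⟨χ.conductor_ne_zero⟩
  refine ⟨hχ1, ?_, ?_, ?_⟩
  · have h1 : χ.conductor ≠ 1 := fun h =>
      hχ1 (DirichletCharacter.eq_one_iff_conductor_eq_one.2 h)
    have h0 := χ.conductor_ne_zero
    omega
  · refine Nat.le_floor ?_
    calc (χ.conductor : ℝ) ≤ d := by
          exact_mod_cast Nat.le_of_dvd (Nat.pos_of_ne_zero (NeZero.ne d)) χ.conductor_dvd_level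
      _ ≤ x ^ θ := hd
      _ ≤ x ^ max θ 1 := Real.rpow_le_rpow_of_exponent_le hx (le_max_left _ _)
  · exact (χ.LFunction_eq_zero_iff_primitiveCharacter (by linarith) hz1).1 hLz

/-! ### One zero per character, and the count by Théorème 14 -/

/-- **One zero per character** (classical choice): a selector `Z(q, χ)` which is a singleton
`{ρ_χ}` — a zero `ρ_χ ≠ 1` of `L(s, χ)` in the box `e < re ρ_χ`, `|im ρ_χ| ≤ T` — when `χ ≠ χ₀` has
such a zero, and `∅` otherwise. [folklore] -/
theorem exists_selector (e T : ℝ) :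
    ∃ Z : (q : ℕ) → DirichletCharacter ℂ q → Finset ℂ,
      (∀ (q : ℕ) [NeZero q] (χ : DirichletCharacter ℂ q), ∀ ρ ∈ Z q χ,
          χ ≠ 1 ∧ e < ρ.re ∧ |ρ.im| ≤ T ∧ ρ ≠ 1 ∧ χ.LFunction ρ = 0) ∧
      (∀ (q : ℕ) [NeZero q] (χ : DirichletCharacter ℂ q) (z : ℂ), χ ≠ 1 → e < z.re →
          |z.im| ≤ T → z ≠ 1 → χ.LFunction z = 0 → (Z q χ).Nonempty) := by
  classical
  refine ⟨fun q χ => if h : ∃ (_ : NeZero q) (z : ℂ),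
      χ ≠ 1 ∧ e < z.re ∧ |z.im| ≤ T ∧ z ≠ 1 ∧ χ.LFunction z = 0 then {h.choose_spec.choose} else ∅,
    fun q _ χ ρ hρ => ?_, fun q inst χ z h1 h2 h3 h4 h5 => ?_⟩
  · by_cases h : ∃ (_ : NeZero q) (z : ℂ), χ ≠ 1 ∧ e < z.re ∧ |z.im| ≤ T ∧ z ≠ 1 ∧ χ.LFunction z = 0
    · simp only [dif_pos h, Finset.mem_singleton] at hρ
      rw [hρ]
      exact h.choose_spec.choose_spec
    · simp only [dif_neg h, Finset.notMem_empty] at hρ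
  · have h : ∃ (_ : NeZero q) (z : ℂ), χ ≠ 1 ∧ e < z.re ∧ |z.im| ≤ T ∧ z ≠ 1 ∧ χ.LFunction z = 0 :=
      ⟨inst, z, h1, h2, h3, h4, h5⟩
    simp only [dif_pos h]
    exact Finset.singleton_nonempty _

open scoped Classical in
/-- **Counting.** If every bad modulus `m ≥ 2` carries a primitive character `ψ ≠ χ₀` and a zero
`ρ ∈ Z(m, ψ)` of `L(s, ψ)` with `re ρ ≥ α`, then the number of bad moduli in `[2, ⌊P⌋]` is at most
the triple sum `∑_{2 ≤ q ≤ P} ∑*_χ ∑_{ρ ∈ Z(q,χ), β ≥ α} m(ρ)` of Bombieri's Théorème 14 (each zero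
of `L(s, ψ)`, `ψ ≠ χ₀`, has multiplicity `m(ρ) ≥ 1`, `zeroOrder_pos_iff`). [folklore] -/
theorem card_filter_le_sum {P α : ℝ} (Z : (q : ℕ) → DirichletCharacter ℂ q → Finset ℂ)
    (bad : ℕ → Prop) [DecidablePred bad]
    (hbad : ∀ (m : ℕ) [NeZero m], 2 ≤ m → bad m →
      ∃ ψ : DirichletCharacter ℂ m, ψ.IsPrimitive ∧ ψ ≠ 1 ∧
        ∃ ρ ∈ Z m ψ, α ≤ ρ.re ∧ ψ.LFunction ρ = 0) :
    (((Finset.Ico 2 (⌊P⌋₊ + 1)).filter bad).card : ℝ) ≤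
      ∑ q' ∈ Finset.Ico 1 ⌊P⌋₊, ∑ χ : DirichletCharacter ℂ (q' + 1) with χ.IsPrimitive,
        ∑ ρ ∈ Z (q' + 1) χ with α ≤ ρ.re, (zeroOrder χ ρ : ℝ) := by
  rw [natCast_card_filter]
  have hshift : ∑ m ∈ Finset.Ico 2 (⌊P⌋₊ + 1), (if bad m then (1 : ℝ) else 0) =
      ∑ q' ∈ Finset.Ico 1 ⌊P⌋₊, (if bad (q' + 1) then (1 : ℝ) else 0) :=
    (Finset.sum_Ico_add' (fun m => if bad m then (1 : ℝ) else 0) 1 ⌊P⌋₊ 1).symm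
  rw [hshift]
  refine Finset.sum_le_sum fun q' hq' => ?_
  have hq'1 : 1 ≤ q' := (Finset.mem_Ico.1 hq').1
  split_ifs with hq
  · obtain ⟨ψ, hprim, hψ1, ρ, hρ, hα, hL⟩ := hbad (q' + 1) (by omega) hq
    have h1 : (1 : ℝ) ≤ zeroOrder ψ ρ := by exact_mod_cast (zeroOrder_pos_iff ψ hψ1 ρ).2 hL
    refine h1.trans ?_
    calc (zeroOrder ψ ρ : ℝ) ≤ ∑ ρ' ∈ Z (q' + 1) ψ with α ≤ ρ'.re, (zeroOrder ψ ρ' : ℝ) :=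
          Finset.single_le_sum (f := fun ρ' => (zeroOrder ψ ρ' : ℝ)) (fun _ _ => Nat.cast_nonneg _)
            (Finset.mem_filter.2 ⟨hρ, hα⟩)
      _ ≤ ∑ χ : DirichletCharacter ℂ (q' + 1) with χ.IsPrimitive,
            ∑ ρ' ∈ Z (q' + 1) χ with α ≤ ρ'.re, (zeroOrder χ ρ' : ℝ) :=
          Finset.single_le_sum
            (f := fun χ => ∑ ρ' ∈ Z (q' + 1) χ with α ≤ ρ'.re, (zeroOrder χ ρ' : ℝ))
            (fun _ _ => Finset.sum_nonneg fun _ _ => Nat.cast_nonneg _)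
            (Finset.mem_filter.2 ⟨Finset.mem_univ _, hprim⟩)
  · exact Finset.sum_nonneg fun _ _ => Finset.sum_nonneg fun _ _ => Nat.cast_nonneg _

/-! ### The stub -/

/-- **(Z2) Few bad conductors.** For every `θ, K', H` there are `E₀, x₀` such that for `x ≥ x₀`
there is a set `S` of at most `(log x)^{E₀}` moduli, each carrying a Dirichlet `L`-zero `z ≠ 1` in
the Linnik box `1 − K' log log x/log x < re z`, `|im z| ≤ (log x)^H`, such that every modulus
`d ≤ x^θ` carrying such a box zero is a multiple of a member of `S`.  `S` is the set of conductors
in `[2, x^{max θ 1}]` of primitive characters with a box zero; the count is Bombieri's log-free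
density theorem (`logFreeDensity_dirichlet`, *Le grand crible* §6 Théorème 14) with one zero per
character, the cover is the passage to the inducing primitive character plus de la Vallée Poussin's
region for the principal ones. [cite: Bombieri1987GrandCrible, §6 Théorème 14] -/
theorem stub_fewBadConductors :
    ∀ θ K' H : ℝ, ∃ E₀ x₀ : ℝ, ∀ x : ℝ, x₀ ≤ x →
      ∃ S : Finset ℕ, (S.card : ℝ) ≤ Real.log x ^ E₀ ∧
        (∀ s ∈ S, ∃ (_ : NeZero s) (χ : DirichletCharacter ℂ s) (z : ℂ),
            1 - K' * Real.log (Real.log x) / Real.log x < z.re ∧ |z.im| ≤ Real.log x ^ H ∧ z ≠ 1 ∧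
              DirichletCharacter.LFunction χ z = 0) ∧
        ∀ (d : ℕ) [NeZero d] (χ : DirichletCharacter ℂ d) (z : ℂ), (d : ℝ) ≤ x ^ θ →
          1 - K' * Real.log (Real.log x) / Real.log x < z.re → |z.im| ≤ Real.log x ^ H → z ≠ 1 →
            DirichletCharacter.LFunction χ z = 0 → ∃ s ∈ S, s ∣ d := by
  classical
  intro θ K' H
  obtain ⟨c_D, C_D, -, hC_D, hdens⟩ := logFreeDensity_dirichlet
  obtain ⟨c, hc, hzfr⟩ := classicalZFRData_riemannZeta.zeroFree
  obtain ⟨x₀, hx₀⟩ := Filter.eventually_atTop.1 ((eventually_ge_atTop (2 : ℝ)).and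
    ((eventually_mul_loglog_pow_le_log 4 0).and
    ((eventually_mul_loglog_pow_le_log (4 * max K' 0) 1).and
    ((eventually_mul_loglog_pow_le_log (8 * max K' 0 / c) 1).and
    ((eventually_mul_loglog_pow_le_log (2 * max K' 0 * |H| / c) 2).and
    ((eventually_mul_loglog_pow_le_log |H| 1).and
      (eventually_mul_loglog_pow_le_log C_D 0)))))))
  refine ⟨c_D * max θ 1 * max K' 0 + 1, x₀, fun x hx => ?_⟩
  obtain ⟨h2x, hL4, hK4, hE4, hE5, hH, hCD⟩ := hx₀ x hx
  simp only [pow_zero, mul_one, pow_one] at hL4 hK4 hE4 hH hCD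
  obtain ⟨hL0, -, hα34, hα1, hαe⟩ := basic hL4 hK4
  have hreg := box_subset_region hc hL4 hE4 hE5
  have hx1 : 1 ≤ x := by linarith
  have hP2 : 2 ≤ x ^ max θ 1 := h2x.trans (Real.self_le_rpow_of_one_le hx1 (le_max_right _ _))
  have hhgt := log_rpow_le_pow_six h2x hL4 hH (le_max_right θ 1)
  -- one zero per character, and Théorème 14
  obtain ⟨Z, hZ1, hZ2⟩ := exists_selector (1 - K' * Real.log (Real.log x) / Real.log x)
    (Real.log x ^ H)
  have hZ : ∀ (q' : ℕ) (χ : DirichletCharacter ℂ (q' + 1)), ∀ ρ ∈ Z (q' + 1) χ,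
      χ.LFunction ρ = 0 ∧ 0 < ρ.re ∧ ρ.re < 1 ∧ |ρ.im| ≤ (x ^ max θ 1) ^ 6 := by
    intro q' χ ρ hρ
    obtain ⟨hχ1, hre, him, -, hLρ⟩ := hZ1 (q' + 1) χ ρ hρ
    refine ⟨hLρ, by linarith, lt_of_not_ge fun h => ?_, him.trans hhgt⟩
    exact DirichletCharacter.LFunction_ne_zero_of_one_le_re χ (Or.inl hχ1) h hLρ
  have hsum := hdens (x ^ max θ 1) hP2 Z hZ (1 - max K' 0 * Real.log (Real.log x) / Real.log x)
    (by linarith) hα1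
  refine ⟨(Finset.Ico 2 (⌊x ^ max θ 1⌋₊ + 1)).filter (fun m => ∃ (_ : NeZero m)
      (ψ : DirichletCharacter ℂ m), ψ.IsPrimitive ∧ ∃ z : ℂ,
        (1 - K' * Real.log (Real.log x) / Real.log x < z.re ∧ |z.im| ≤ Real.log x ^ H ∧ z ≠ 1) ∧
          ψ.LFunction z = 0), ?_, ?_, ?_⟩
  · -- the count
    have hbad' : ∀ (m : ℕ) [NeZero m], 2 ≤ m → (∃ (_ : NeZero m)
        (ψ : DirichletCharacter ℂ m), ψ.IsPrimitive ∧ ∃ z : ℂ,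
          (1 - K' * Real.log (Real.log x) / Real.log x < z.re ∧ |z.im| ≤ Real.log x ^ H ∧ z ≠ 1) ∧
            ψ.LFunction z = 0) →
        ∃ ψ : DirichletCharacter ℂ m, ψ.IsPrimitive ∧ ψ ≠ 1 ∧
          ∃ ρ ∈ Z m ψ, 1 - max K' 0 * Real.log (Real.log x) / Real.log x ≤ ρ.re ∧
            ψ.LFunction ρ = 0 := by
      intro m _ hm hbad
      obtain ⟨inst', ψ, hprim, z, ⟨hre, him, hz1⟩, hLz⟩ := hbad
      have hψ1 : ψ ≠ 1 := fun h => by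
        have h1 := (DirichletCharacter.isPrimitive_def ψ).1 hprim
        rw [h, DirichletCharacter.conductor_one] at h1
        omega
      obtain ⟨ρ, hρ⟩ := hZ2 m ψ z hψ1 hre him hz1 hLz
      obtain ⟨-, hre', -, -, hLρ⟩ := hZ1 m ψ ρ hρ
      exact ⟨ψ, hprim, hψ1, ρ, hρ, by linarith, hLρ⟩
    have hcount := card_filter_le_sum (P := x ^ max θ 1) Z _ hbad'
    have hfin := density_bound_le (θ' := max θ 1) (Kp := max K' 0) (c_D := c_D) h2x hL4 hCD
    exact (hcount.trans hsum).trans hfin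
  · -- members of `S` are bad
    intro s hs
    obtain ⟨-, inst, ψ, -, z, ⟨h1, h2, h3⟩, h4⟩ := Finset.mem_filter.1 hs
    exact ⟨inst, ψ, z, h1, h2, h3, h4⟩
  · -- cover
    intro d inst χ z hd h1 h2 h3 h4
    obtain ⟨-, hf2, hfP, hLψ⟩ :=
      cover hc hzfr hx1 hL0 (by linarith) hreg χ hd h1 h2 h3 h4
    exact ⟨χ.conductor, Finset.mem_filter.2 ⟨Finset.mem_Ico.2 ⟨hf2, Nat.lt_succ_of_le hfP⟩,
      ⟨χ.conductor_ne_zero⟩, χ.primitiveCharacter, χ.primitiveCharacter_isPrimitive, z,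
        ⟨h1, h2, h3⟩, hLψ⟩, χ.conductor_dvd_level⟩

end Summit.Parity.GeneralizedHardyLittlewood.Theorems.DilatedTableChowla.FewBadConductors

end
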